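import Literature.Geometry.ComplexHyperbolic.UnitBallKCentralOrbitalIntegral   -- ★ p842313: pencil algebra (`pencil_smul`, `mat_conj_kCentral_eq`), orbit map, `mat_inv`
import Literature.Geometry.ComplexHyperbolic.UnitBallNegativeLineProjector    -- ★ p842362: `N(w) = w w* J` entries, `Q`-calculus
import Literature.Geometry.ComplexHyperbolic.UnitBallFrameTorus               -- ★ (A-p19): brings ★ `UnitBallIsotropyBlock` (`ulBlock`, stabiliser is block-diagonal) and ★ `UnitBallSection` (`sec`)
import HarnessLib

/-!
# Conjugates of a REGULAR torus element of `U(2,1)`: the spectral decomposition along the columns of `g`, and the flag `(g • x₀, ℂ·g e₀)` over the ball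
# (ROAD A, road (β) toward (A6), brick (β-0); Rogawski 1990 §8.4 pp. 126–127; Goldman 1999 §3.1.1; Helgason 2000 Ch. I §1 Thm. 1.9)

Topic `Geometry/ComplexHyperbolic`; namespace `Literature.Geometry.ComplexHyperbolic.BallModel`.  THEOREMS ONLY (no `def`, no instance, no notation, no axiom, no named fact,
no `sorry`).  Cell `pub/hodgecm-mathlib`, ENGINE T1 (crux H413 = `stmt-HodgeConjecture-24833`); ROAD A (in-house road to the (L_{U(2,1)}) letter
`ArchCentralLimitFormulaRankTwo` = closer `stub_L21` ∕ SdArch `stub_ArchCentralLimitU21`), road (β) «direct `U(2,1)` geometry» toward the corner-regularity row (A6)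
(F0P3a-p02 (g12) census `CENSUS-A6-InHouseScoping` §3 (β); F0P3a-p05 (g13) HANDOFF «SUCCESSOR PLAN (β-0)»); author F0P3a-p05 (g14), 2026-09-01.  Self-contained in the ball model
★ `UnitBallU21` (`J = diag(1,1,−1)`, `U21`, `mat`, `Ball`, `x₀`, `lift`, `g • z`), ★ `UnitBallKCentralOrbitalIntegral` (the pencil `P(w) = Q(w)⁻¹•(w w* J)`).

THE MATHEMATICS.  For `g ∈ G = U(2,1)` write `c_p(g) = g e_p` for the `p`-th column of `mat g` (`p = 0,1,2`) and `N(w) = w w* J` (the tree's `vecMulVec w (star w) * J`).  From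
`gᴴ J g = J`: the columns are pairwise `J`-orthogonal with `Q(c₀) = Q(c₁) = 1`, `Q(c₂) = −1` (§2), and `g⁻¹ = J gᴴ J` gives the COMPLETENESS RELATION `N(c₀) + N(c₁) − N(c₂) = 1` (§3) and,
for every torus element `t = diag(z₀,z₁,z₂)` (`z_p ∈ S¹`), the SPECTRAL DECOMPOSITION OF THE CONJUGATE

  **`mat(g·t·g⁻¹) = z₀·N(c₀(g)) + z₁·N(c₁(g)) − z₂·N(c₂(g))`**  (§4, `mat_conj_diagonal_eq_sum`),

equivalently, eliminating `N(c₁)` by completeness and recognising `−N(c₂(g)) = P(lift(g • x₀))` (the pencil of ★ `mat_conj_kCentral_eq`; `c₂(g) = g·lift x₀`, `Q(c₂) = −1`):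

  **`mat(g·t·g⁻¹) = z₁•1 + (z₂ − z₁)•P(lift(g • x₀)) + (z₀ − z₁)•N(c₀(g))`**  (§4, `mat_conj_diagonal_eq`).

So the conjugation class of a REGULAR elliptic element is read through the FLAG `(ℓ, m) = (g • x₀, ℂ·c₀(g))`: a point of the ball `𝔹² = G∕K` (a negative line) and a positive line
`m ⊂ ℓ^⊥` (`c₀(g) ⊥_J lift(g • x₀)`, `Q(c₀(g)) = 1`, §2∕§5) — `G∕T → G∕K` is the `ℙ¹`-bundle of positive lines in `ℓ^⊥`.  At `z₀ = z₁` the last term drops and the formula IS ★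
`mat_conj_kCentral_eq` (the compact wall).  §5 reads the flag in the two-level parametrisation `g = sec z · k`, `k ∈ K = Stab(x₀)` (★ `sec`, ★ `stabilizerEquivK21`): `(sec z·k) • x₀ = z`
and `c₀(sec z·k) = secMat z *ᵥ (k₀₀, k₁₀, 0)` with `|k₀₀|² + |k₁₀|² = 1` (the first column of the `U(2)`-block of `k`), so the fibre coordinate is a point of `S³ ⊂ ℂ²` pushed by the
boost `secMat z`.  §6: continuity of `g ↦ N(c_p(g))` and of `g ↦ mat(g·t·g⁻¹)` (integrability bookkeeping for the two-level orbital integral, brick (β-1b)).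
HONEST LABEL: HC_CM is proved only modulo the printed citations until rung 0 closes; this file is matrix algebra over ★ ball-model files and pays nothing by itself.

## References
* [Rogawski1990] J. D. Rogawski, *Automorphic Representations of Unitary Groups in Three Variables*, Ann. of Math. Stud. 123 (1990), §8.4 pp. 126–127 (orbital integrals of the
  compact torus `T ⊂ U(2,1)` near the centre).
* [Goldman1999] W. M. Goldman, *Complex Hyperbolic Geometry* (1999), §3.1.1 (negative∕positive vectors, orthogonal projections `w w* J ∕ ⟨w,w⟩`, polar vectors of complex geodesics).
* [Helgason2000] S. Helgason, *Groups and Geometric Analysis* (2000), Ch. I §1 No. 2, Thm. 1.9 (`G → G∕K`, sections, `∫_G = ∫_{G∕K}∫_K`).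
* [Jacobowitz1990] H. Jacobowitz, *An Introduction to CR Structures* (1990), Ch. 2 §1 Lemma 6 (the ball model of `U(2,1)`, `Stab(0) = U(2) × U(1)`).
-/

set_option autoImplicit false

noncomputable section

open Matrix Complex ComplexConjugate MulAction Topology

namespace Literature.Geometry.ComplexHyperbolic

namespace BallModel

/-! ## §1 Torus elements `diag(z₀,z₁,z₂)`, `z_p ∈ S¹`, lie in `U(2,1)` -/

section Torus

/-- **`diag(z) ∈ U(2,1)` for `z ∈ (S¹)³`**: `diag(z̄) J diag(z) = J` (diagonal matrices commute, `z̄_p z_p = 1`).  This is the membership witness `hz` of the cell's token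
`mkU21 (Matrix.diagonal fun i => (z i : ℂ)) hz` (★ `integral_comp_conj_eq_integral_map_mkU21`); any two witnesses give the same element. [cite: Rogawski1990, §8.4 p. 126] -/
theorem diagonal_circle_preserves (z : Fin 3 → Circle) :
    (Matrix.diagonal fun i => (z i : ℂ))ᴴ * J * Matrix.diagonal (fun i => (z i : ℂ)) = J := by
  have hz : ∀ i, conj (z i : ℂ) * (z i : ℂ) = 1 := fun i => by
    rw [← Complex.normSq_eq_conj_mul_self, Circle.normSq_coe, Complex.ofReal_one]
  rw [Matrix.diagonal_conjTranspose, J, Matrix.diagonal_mul_diagonal, Matrix.diagonal_mul_diagonal]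
  congr 1
  funext i
  rw [Pi.star_apply, Complex.star_def]
  linear_combination ((![(1 : ℂ), 1, -1] : Fin 3 → ℂ) i) * hz i

/-- `mat (mkU21 (diag z) _) = diag z`. [cite: Rogawski1990, §8.4 p. 126] -/
theorem mat_mkU21_diagonal (z : Fin 3 → Circle) (hz : (Matrix.diagonal fun i => (z i : ℂ))ᴴ * J * Matrix.diagonal (fun i => (z i : ℂ)) = J) :
    mat (mkU21 (Matrix.diagonal fun i => (z i : ℂ)) hz) = Matrix.diagonal fun i => (z i : ℂ) := rfl

end Torus

/-! ## §2 The columns `c_p(g) = g e_p` of `g ∈ U(2,1)`: `J`-orthonormal frame of signature `(1,1,−1)` -/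

section Columns

/-- The `p`-th column of `mat g` is `mat g *ᵥ e_p`. [cite: Jacobowitz1990, Ch. 2 §1] -/
theorem mulVec_single_eq_matCol (g : U21) (p : Fin 3) : mat g *ᵥ Pi.single p 1 = fun j => mat g j p :=
  mulVec_single_one (mat g) p

/-- **THE COLUMNS ARE `J`-ORTHONORMAL**: `c_p(g)* J c_q(g) = J_{pq}` (the `(p,q)` entry of `gᴴ J g = J`). [cite: Jacobowitz1990, Ch. 2 §1 (p. 40)] [cite: Goldman1999, §3.1.1] -/
theorem star_matCol_dotProduct_J_mulVec_matCol (g : U21) (p q : Fin 3) :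
    star (fun j => mat g j p) ⬝ᵥ (J *ᵥ fun j => mat g j q) = J p q := by
  have h := congrFun (congrFun (mat_mem g) p) q
  rw [← h]
  simp only [Matrix.mul_apply, Matrix.conjTranspose_apply, dotProduct, Matrix.mulVec, Pi.star_apply, Finset.sum_mul, Finset.mul_sum]
  rw [Finset.sum_comm]
  simp only [mul_assoc]

/-- `c_p(g)* J c_q(g) = 0` for `p ≠ q`: distinct columns are `J`-orthogonal. [cite: Goldman1999, §3.1.1] -/
theorem star_matCol_dotProduct_J_mulVec_matCol_of_ne (g : U21) {p q : Fin 3} (hpq : p ≠ q) :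
    star (fun j => mat g j p) ⬝ᵥ (J *ᵥ fun j => mat g j q) = 0 := by
  rw [star_matCol_dotProduct_J_mulVec_matCol, J_apply_of_ne hpq]

/-- **`Q(c_p(g)) = J_{pp}`**: `Q(c₀) = Q(c₁) = 1`, `Q(c₂) = −1` (★ `col_identity`, restated for `Q`). [cite: Jacobowitz1990, Ch. 2 §1 (p. 40)] -/
theorem Q_matCol (g : U21) (p : Fin 3) : Q (fun j => mat g j p) = if p = 2 then -1 else 1 := by
  have h := col_identity g p
  simpa [Q] using h

/-- `Q(c₀(g)) = 1`: the first column is a POSITIVE unit vector. [cite: Goldman1999, §3.1.1] -/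
theorem Q_matCol_zero (g : U21) : Q (fun j => mat g j 0) = 1 := by
  rw [Q_matCol]; simp

/-- `Q(c₁(g)) = 1`. [cite: Goldman1999, §3.1.1] -/
theorem Q_matCol_one (g : U21) : Q (fun j => mat g j 1) = 1 := by
  rw [Q_matCol]; simp

/-- `Q(c₂(g)) = −1`: the last column is a NEGATIVE unit vector (it lifts the point `g • x₀` of the ball). [cite: Goldman1999, §3.1.1] -/
theorem Q_matCol_two (g : U21) : Q (fun j => mat g j 2) = -1 := by
  rw [Q_matCol]; simp

/-- `c₂(g) = g · lift x₀ = W3 g x₀` (★ `W3_x₀`, as functions). [cite: Jacobowitz1990, Ch. 2 §1] -/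
theorem matCol_two_eq_W3_x₀ (g : U21) : (fun j => mat g j 2) = W3 g x₀ :=
  funext fun j => (W3_x₀ g j).symm

/-- **`lift(g • x₀)` IS THE LAST COLUMN UP TO SCALE**: `lift(g • x₀) = (g₂₂)⁻¹ • c₂(g)`. [cite: Jacobowitz1990, Ch. 2 §1] -/
theorem lift_smul_x₀_eq (g : U21) : lift (g • x₀) = (mat g 2 2)⁻¹ • fun j => mat g j 2 := by
  rw [smul_def, lift_act, matCol_two_eq_W3_x₀, W3_x₀]

/-- **THE FIBRE VECTOR IS ORTHOGONAL TO THE BASE POINT**: `lift(g • x₀)* J c₀(g) = 0` — the positive line `ℂ·c₀(g)` lies in the positive plane `(g • x₀)^⊥`.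
[cite: Goldman1999, §3.1.1] -/
theorem star_lift_smul_x₀_dotProduct_J_mulVec_matCol_zero (g : U21) :
    star (lift (g • x₀)) ⬝ᵥ (J *ᵥ fun j => mat g j 0) = 0 := by
  rw [lift_smul_x₀_eq, star_smul, smul_dotProduct, star_matCol_dotProduct_J_mulVec_matCol_of_ne g (by decide : (2 : Fin 3) ≠ 0), smul_zero]

/-- Likewise `lift(g • x₀)* J c₁(g) = 0`. [cite: Goldman1999, §3.1.1] -/
theorem star_lift_smul_x₀_dotProduct_J_mulVec_matCol_one (g : U21) :
    star (lift (g • x₀)) ⬝ᵥ (J *ᵥ fun j => mat g j 1) = 0 := by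
  rw [lift_smul_x₀_eq, star_smul, smul_dotProduct, star_matCol_dotProduct_J_mulVec_matCol_of_ne g (by decide : (2 : Fin 3) ≠ 1), smul_zero]

end Columns

/-! ## §3 Completeness: `N(c₀) + N(c₁) − N(c₂) = 1` -/

section Completeness

/-- `g J gᴴ J = 1` (`J gᴴ J = g⁻¹`, ★ `mat_mul_J_conjTranspose_J`, reassociated). [cite: Jacobowitz1990, Ch. 2 §1] -/
theorem mat_mul_J_mul_conjTranspose_mul_J (g : U21) : mat g * J * (mat g)ᴴ * J = 1 := by
  have h := mat_mul_J_conjTranspose_J g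
  simpa only [Matrix.mul_assoc] using h

/-- The `(i,k)` entry of `Σ_p J_{pp} N(c_p(g))` is that of `g J gᴴ J`. [cite: Goldman1999, §3.1.1] -/
theorem sum_J_smul_vecMulVec_matCol_apply (g : U21) (i k : Fin 3) :
    (∑ p : Fin 3, J p p • (vecMulVec (fun j => mat g j p) (star fun j => mat g j p) * J)) i k = (mat g * J * (mat g)ᴴ * J) i k := by
  rw [Matrix.sum_apply]
  simp only [Matrix.smul_apply, smul_eq_mul, vecMulVec_star_mul_J_apply]
  rw [J, Matrix.mul_diagonal, Matrix.mul_apply]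
  simp only [Matrix.mul_diagonal, Matrix.conjTranspose_apply, Complex.star_def, Finset.sum_mul]
  refine Finset.sum_congr rfl fun p _ => ?_
  rw [Matrix.diagonal_apply_eq, Matrix.diagonal_apply_eq]
  ring

/-- **COMPLETENESS OF THE `J`-ORTHONORMAL FRAME OF COLUMNS**: `Σ_p J_{pp} • N(c_p(g)) = N(c₀) + N(c₁) − N(c₂) = 1` (`= g J gᴴ J = g g⁻¹`).
[cite: Goldman1999, §3.1.1] [cite: Jacobowitz1990, Ch. 2 §1] -/
theorem sum_J_smul_vecMulVec_matCol_eq_one (g : U21) :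
    ∑ p : Fin 3, J p p • (vecMulVec (fun j => mat g j p) (star fun j => mat g j p) * J) = 1 := by
  ext i k
  rw [sum_J_smul_vecMulVec_matCol_apply, mat_mul_J_mul_conjTranspose_mul_J]

/-- The same, spelled out: `N(c₀(g)) + N(c₁(g)) − N(c₂(g)) = 1`. [cite: Goldman1999, §3.1.1] -/
theorem vecMulVec_matCol_zero_add_one_sub_two (g : U21) :
    vecMulVec (fun j => mat g j 0) (star fun j => mat g j 0) * J + vecMulVec (fun j => mat g j 1) (star fun j => mat g j 1) * J
      - vecMulVec (fun j => mat g j 2) (star fun j => mat g j 2) * J = 1 := by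
  have h := sum_J_smul_vecMulVec_matCol_eq_one g
  rw [Fin.sum_univ_three, J_apply_00, J_apply_11, J_apply_22, one_smul, one_smul, neg_one_smul, ← sub_eq_add_neg] at h
  exact h

end Completeness

/-! ## §4 The conjugate of a regular torus element: spectral form and flag form -/

section Conj

/-- `mat(g·t·g⁻¹) = mat g · diag z · J (mat g)ᴴ J` for `t = diag z`. [cite: Rogawski1990, §8.4 p. 126] -/
theorem mat_conj_diagonal_eq_mul (g : U21) (z : Fin 3 → Circle)
    (hz : (Matrix.diagonal fun i => (z i : ℂ))ᴴ * J * Matrix.diagonal (fun i => (z i : ℂ)) = J) :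
    mat (g * mkU21 (Matrix.diagonal fun i => (z i : ℂ)) hz * g⁻¹) = mat g * Matrix.diagonal (fun i => (z i : ℂ)) * (J * (mat g)ᴴ * J) := by
  rw [← mat_inv]
  simp only [mat, Subgroup.coe_mul, Units.val_mul]
  rfl

/-- The `(i,k)` entry of `Σ_p (z_p J_{pp}) • N(c_p(g))` is that of `g · diag z · J gᴴ J`. [cite: Goldman1999, §3.1.1] -/
theorem sum_smul_vecMulVec_matCol_apply (g : U21) (z : Fin 3 → Circle) (i k : Fin 3) :
    (∑ p : Fin 3, ((z p : ℂ) * J p p) • (vecMulVec (fun j => mat g j p) (star fun j => mat g j p) * J)) i k =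
      (mat g * Matrix.diagonal (fun i => (z i : ℂ)) * (J * (mat g)ᴴ * J)) i k := by
  rw [Matrix.sum_apply]
  simp only [Matrix.smul_apply, smul_eq_mul, vecMulVec_star_mul_J_apply]
  rw [show mat g * Matrix.diagonal (fun i => (z i : ℂ)) * (J * (mat g)ᴴ * J) = (mat g * Matrix.diagonal (fun i => (z i : ℂ)) * J) * (mat g)ᴴ * J by
    simp only [Matrix.mul_assoc]]
  rw [J, Matrix.mul_diagonal, Matrix.mul_apply]
  simp only [Matrix.mul_diagonal, Matrix.conjTranspose_apply, Complex.star_def, Finset.sum_mul]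
  refine Finset.sum_congr rfl fun p _ => ?_
  rw [Matrix.diagonal_apply_eq, Matrix.diagonal_apply_eq]
  ring

/-- **SPECTRAL DECOMPOSITION OF THE CONJUGATE OF A TORUS ELEMENT**: for `g ∈ U(2,1)` and `t = diag(z₀,z₁,z₂)`, `z_p ∈ S¹`,
`mat(g·t·g⁻¹) = Σ_p (z_p J_{pp}) • N(c_p(g)) = z₀ N(c₀) + z₁ N(c₁) − z₂ N(c₂)`, `N(w) = w w* J`, `c_p(g)` the columns of `g` — the eigen-decomposition along the `J`-orthonormal
frame `(g e₀, g e₁, g e₂)`. [cite: Rogawski1990, §8.4 pp. 126–127] [cite: Goldman1999, §3.1.1] -/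
theorem mat_conj_diagonal_eq_sum (g : U21) (z : Fin 3 → Circle)
    (hz : (Matrix.diagonal fun i => (z i : ℂ))ᴴ * J * Matrix.diagonal (fun i => (z i : ℂ)) = J) :
    mat (g * mkU21 (Matrix.diagonal fun i => (z i : ℂ)) hz * g⁻¹) =
      ∑ p : Fin 3, ((z p : ℂ) * J p p) • (vecMulVec (fun j => mat g j p) (star fun j => mat g j p) * J) := by
  rw [mat_conj_diagonal_eq_mul]
  ext i k
  rw [sum_smul_vecMulVec_matCol_apply]

/-- **THE PENCIL AT THE BASE POINT IS MINUS THE LAST COLUMN PROJECTOR**: `P(lift(g • x₀)) = −N(c₂(g))` (`lift(g • x₀) = g₂₂⁻¹ c₂`, the pencil sees only the line ★ `pencil_smul`,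
and `Q(c₂) = −1`). [cite: Goldman1999, §3.1.1] [cite: Jacobowitz1990, Ch. 2 §1] -/
theorem pencil_lift_smul_x₀_eq_neg (g : U21) :
    (((Q (lift (g • x₀)) : ℝ) : ℂ))⁻¹ • (vecMulVec (lift (g • x₀)) (star (lift (g • x₀))) * J) =
      -(vecMulVec (fun j => mat g j 2) (star fun j => mat g j 2) * J) := by
  rw [lift_smul_x₀_eq, pencil_smul _ (inv_ne_zero (mat_two_two_ne_zero g)), Q_matCol_two]
  push_cast
  rw [inv_neg, inv_one, neg_one_smul]

/-- **THE FLAG FORM (β-0)**: for `g ∈ U(2,1)` and `t = diag(z₀,z₁,z₂)`, `z_p ∈ S¹`: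
`mat(g·t·g⁻¹) = z₁•1 + (z₂ − z₁)•P(lift(g • x₀)) + (z₀ − z₁)•N(c₀(g))` — base point `g • x₀ ∈ 𝔹²` (negative line, through the pencil `P` of ★ `mat_conj_kCentral_eq`) and fibre
`ℂ·c₀(g) ⊂ (g • x₀)^⊥` (positive line, through `N(c₀) = c₀c₀* J`, `Q(c₀) = 1`).  At `z₀ = z₁` this IS ★ `mat_conj_kCentral_eq`. [cite: Rogawski1990, §8.4 pp. 126–127] [cite: Goldman1999, §3.1.1] -/
theorem mat_conj_diagonal_eq (g : U21) (z : Fin 3 → Circle)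
    (hz : (Matrix.diagonal fun i => (z i : ℂ))ᴴ * J * Matrix.diagonal (fun i => (z i : ℂ)) = J) :
    mat (g * mkU21 (Matrix.diagonal fun i => (z i : ℂ)) hz * g⁻¹) =
      (z 1 : ℂ) • (1 : Matrix (Fin 3) (Fin 3) ℂ)
        + ((z 2 : ℂ) - z 1) • ((((Q (lift (g • x₀)) : ℝ) : ℂ))⁻¹ • (vecMulVec (lift (g • x₀)) (star (lift (g • x₀))) * J))
        + ((z 0 : ℂ) - z 1) • (vecMulVec (fun j => mat g j 0) (star fun j => mat g j 0) * J) := by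
  rw [mat_conj_diagonal_eq_sum, pencil_lift_smul_x₀_eq_neg, ← vecMulVec_matCol_zero_add_one_sub_two g, Fin.sum_univ_three,
    J_apply_00, J_apply_11, J_apply_22]
  module

/-- The flag form at a `K`-CENTRAL element (`z₀ = z₁ = u`, `z₂ = v`) is ★ `mat_conj_kCentral_eq`'s right-hand side: consistency check, and the form in which the compact wall
embeds in the regular family. [cite: Rogawski1990, §8.4 pp. 126–127] -/
theorem mat_conj_diagonal_eq_of_kCentral (g : U21) (u v : Circle)
    (hz : (Matrix.diagonal fun i => ((![u, u, v] : Fin 3 → Circle) i : ℂ))ᴴ * J * Matrix.diagonal (fun i => ((![u, u, v] : Fin 3 → Circle) i : ℂ)) = J) :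
    mat (g * mkU21 (Matrix.diagonal fun i => ((![u, u, v] : Fin 3 → Circle) i : ℂ)) hz * g⁻¹) =
      (u : ℂ) • (1 : Matrix (Fin 3) (Fin 3) ℂ) + ((v : ℂ) - u) • ((((Q (lift (g • x₀)) : ℝ) : ℂ))⁻¹ • (vecMulVec (lift (g • x₀)) (star (lift (g • x₀))) * J)) := by
  rw [mat_conj_diagonal_eq]
  simp

end Conj

/-! ## §5 The flag in the two-level parametrisation `g = sec z · k`, `k ∈ K = Stab(x₀)` -/

section TwoLevel

/-- `(g·k) • x₀ = g • x₀` for `k` in the stabiliser: the base point of the flag depends only on the coset `gK`. [cite: Helgason2000, Ch. I §1 No. 2] -/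
theorem mul_stabilizer_smul_x₀ (g : U21) (k : stabilizer U21 x₀) : (g * (k : U21)) • x₀ = g • x₀ := by
  rw [mul_smul, k.2]

/-- `(sec z · k) • x₀ = z` (★ `sec_smul_x₀`). [cite: Helgason2000, Ch. I §1 No. 2, Thm. 1.9] -/
theorem sec_mul_stabilizer_smul_x₀ (z : Ball) (k : stabilizer U21 x₀) : (sec z * (k : U21)) • x₀ = z := by
  rw [mul_stabilizer_smul_x₀, sec_smul_x₀]

/-- Columns multiply: `c_p(g·h) = mat g *ᵥ c_p(h)`. [cite: Jacobowitz1990, Ch. 2 §1] -/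
theorem matCol_mul (g h : U21) (p : Fin 3) : (fun j => mat (g * h) j p) = mat g *ᵥ fun j => mat h j p := by
  funext j
  rw [mat_mul, Matrix.mul_apply, Matrix.mulVec, dotProduct]

/-- **THE FIBRE COLUMN OF A STABILISER ELEMENT**: for `k ∈ Stab(x₀) = U(2) × U(1)` (block-diagonal, ★ `mat_row_two_eq_zero_of_smul_x₀`) the first column is
`c₀(k) = (k₀₀, k₁₀, 0)`. [cite: Jacobowitz1990, Ch. 2 §1 Lemma 6(2)] -/
theorem matCol_zero_stabilizer (k : stabilizer U21 x₀) : (fun j => mat (k : U21) j 0) = ![mat (k : U21) 0 0, mat (k : U21) 1 0, 0] := by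
  have h2 : mat (k : U21) 2 0 = 0 := by
    have h := mat_row_two_eq_zero_of_smul_x₀ k.2 0
    simpa using h
  funext j
  fin_cases j
  · rfl
  · rfl
  · simpa using h2

/-- … and it is a unit vector of `ℂ² × 0`: `|k₀₀|² + |k₁₀|² = 1` (`Q(c₀(k)) = 1` with vanishing last entry). [cite: Jacobowitz1990, Ch. 2 §1 Lemma 6(2)] -/
theorem nsq_matCol_zero_stabilizer (k : stabilizer U21 x₀) : nsq ![mat (k : U21) 0 0, mat (k : U21) 1 0] = 1 := by
  have hQ := Q_matCol_zero (k : U21)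
  rw [matCol_zero_stabilizer] at hQ
  simpa [Q, nsq] using hQ

/-- **THE FIBRE COLUMN IN THE TWO-LEVEL PARAMETRISATION**: `c₀(sec z · k) = secMat z *ᵥ (k₀₀, k₁₀, 0)` — a point of the unit sphere `S³ ⊂ ℂ² × 0` pushed by the boost `secMat z`
(★ `sec`) into the positive plane `z^⊥`. [cite: Helgason2000, Ch. I §1 No. 2, Thm. 1.9] [cite: Goldman1999, §3.1.1] -/
theorem matCol_zero_sec_mul_stabilizer (z : Ball) (k : stabilizer U21 x₀) :
    (fun j => mat (sec z * (k : U21)) j 0) = secMat z *ᵥ ![mat (k : U21) 0 0, mat (k : U21) 1 0, 0] := by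
  rw [matCol_mul, matCol_zero_stabilizer, mat_sec]

/-- **THE REGULAR CONJUGATE IN THE TWO-LEVEL PARAMETRISATION**: for `g = sec z · k`,
`mat(g·t·g⁻¹) = z₁•1 + (z₂ − z₁)•P(lift z) + (z₀ − z₁)•N(secMat z *ᵥ (k₀₀, k₁₀, 0))` — base coordinate the ball point `z`, fibre coordinate the unit vector `(k₀₀, k₁₀) ∈ S³`.
[cite: Rogawski1990, §8.4 pp. 126–127] [cite: Helgason2000, Ch. I §1 No. 2, Thm. 1.9] -/
theorem mat_conj_diagonal_sec_mul_stabilizer (z : Ball) (k : stabilizer U21 x₀) (w : Fin 3 → Circle)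
    (hw : (Matrix.diagonal fun i => (w i : ℂ))ᴴ * J * Matrix.diagonal (fun i => (w i : ℂ)) = J) :
    mat (sec z * (k : U21) * mkU21 (Matrix.diagonal fun i => (w i : ℂ)) hw * (sec z * (k : U21))⁻¹) =
      (w 1 : ℂ) • (1 : Matrix (Fin 3) (Fin 3) ℂ)
        + ((w 2 : ℂ) - w 1) • ((((Q (lift z) : ℝ) : ℂ))⁻¹ • (vecMulVec (lift z) (star (lift z)) * J))
        + ((w 0 : ℂ) - w 1) • (vecMulVec (secMat z *ᵥ ![mat (k : U21) 0 0, mat (k : U21) 1 0, 0])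
            (star (secMat z *ᵥ ![mat (k : U21) 0 0, mat (k : U21) 1 0, 0])) * J) := by
  rw [mat_conj_diagonal_eq, sec_mul_stabilizer_smul_x₀, matCol_zero_sec_mul_stabilizer]

end TwoLevel

/-! ## §6 Continuity -/

section Continuity

/-- `g ↦ c_p(g)` is continuous. [cite: Jacobowitz1990, Ch. 2 §1] -/
theorem continuous_matCol (p : Fin 3) : Continuous fun g : U21 => fun j => mat g j p :=
  continuous_pi fun j => continuous_mat.matrix_elem j p

/-- `g ↦ N(c_p(g))` is continuous. [cite: Goldman1999, §3.1.1] -/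
theorem continuous_vecMulVec_matCol (p : Fin 3) : Continuous fun g : U21 => vecMulVec (fun j => mat g j p) (star fun j => mat g j p) * J :=
  ((continuous_matCol p).matrix_vecMulVec (continuous_matCol p).star).mul continuous_const

/-- `g ↦ mat(g·t·g⁻¹)` is continuous (`t` any fixed element). [cite: Rogawski1990, §8.4 p. 126] -/
theorem continuous_mat_conj (t : U21) : Continuous fun g : U21 => mat (g * t * g⁻¹) :=
  continuous_mat.comp ((continuous_id.mul continuous_const).mul continuous_inv)

end Continuity

end BallModel

end Literature.Geometry.ComplexHyperbolic

end
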